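import Literature.MathematicalPhysics.QuantumFieldTheory.Balaban1983to89.B11Eq88LaplaceH1CurrentLetter
import Literature.MathematicalPhysics.QuantumFieldTheory.Balaban1983to89.B9Eq3132KinvPiSubKinvLetterTower
import Literature.MathematicalPhysics.QuantumFieldTheory.Balaban1983to89.B9Eq3126KinvTwoBackgroundLetterTower
import Literature.MathematicalPhysics.QuantumFieldTheory.Balaban1983to89.B9Eq315QkSingleBondTwoBackgroundLetter

/-!
# `Balaban1983to89.B11Eq88LaplaceH1CurrentTwoBackgroundLetter` — T. Bałaban, *The variational problem and background fields in renormalization group method for lattice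
# gauge theories*, Commun. Math. Phys. **102** (1985) 277–309 [Balaban1985Variational] (87)–(88) p. 291, (129) p. 297, (45) p. 285, Prop. 6 (117) p. 295; [Balaban1985BackgroundPropagators]
# (3.122) p. 420, (3.126) p. 420, (3.132)–(3.133) p. 422, Thm 3.4 p. 400, (3.84)–(3.86) p. 407: **THE HILBERT-LEVEL LETTER OF THE COMPOSITE `(Δ̃_{a,k} − Q_k†aQ_k)∘H̃_{1,k} =
# Q_k†((Q_kG̃_kQ_k†)⁻¹ − a)` BETWEEN TWO BACKGROUNDS AT THE FLAT BASE, ∃-FIRST, HEIGHT-FREE** — for a coarse-bond field `z` supported over the bonds at `v`, `‖z‖_∞ ≤ F`, at every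
# fine bond `b`: `‖(Q_k(U)†K̃_k(U)⁻¹z − aQ_k(U)†z − (Q_k(1)†K_k(1)⁻¹z − aQ_k(1)†z))(b)‖ ≤ (j₀ + α)·K·e^{−κ·d_m(Π(b₋), v)}·F` — the two-background twin of this lineage's
# `B11Eq88LaplaceH1CurrentLetter.exists_local_letter_QadjKinvSub` (gen 97): split `= (Q_U† − Q_1†)K̃_U⁻¹z + Q_1†(K̃_U⁻¹ − K_U⁻¹)z + Q_1†(K_U⁻¹ − K_1⁻¹)z − a(Q_U† − Q_1†)z`, the four
# letters (K80) `exists_local_letter_KinvLatticeKPi`, gen 101's slot difference `exists_letter_KinvPi_sub_Kinv` (factor `j₀`) and `K⁻¹`-storey `exists_letter_Kinv_sub_flat` (factor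
# `α`), ne9-leaf-05's two-background single-bond letter of `Q_k†` (`norm_adjoint_QkW_sub_flat_apply_le_local_diagonal`, factor `α`), composed by `letter_comp`; the brick on which the
# two-background one-block letter `δhk′` of the composite current of this generation's `B11Eq88KernelColumnsCompositeTwoBackgrounds` rests

statement-level skeleton of published theorems with citation tags; proofs where landed; nothing here is a claim about the Yang–Mills mass gap

CITATION HEADER (lean-in-tree rule).  Audit cell `pub-balaban`, sub-cell `t4`, BINDER row NE9; NE9 crux-team LEAF PROVER 01 (`b2b-balaban-t4-ne9-formalise-leaf-01`, gen 105; ROUTE (J′),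
the `δ_W` brick; bears_on: R4/N22).  Composed BY NAME, nothing restated (the four letters above, `B9Eq326G1SupRowOfLetters.letter_comp`, `B9Eq315QkSingleBondLetter.norm_adjoint_QkW_apply_le_local_sharp`).
Sources read through the audited headers of those files (`paper:balaban1985-cmp99-background-propagators` pp. 400, 407, 416, 420–422; `paper:balaban1985-cmp102-variational-background`
pp. 285, 291, 295, 297).  NOTHING of print's proof is reproduced: [folklore] letter algebra.

WHAT IS PROVED (sorry-free; proof lane — no `def`).  **`exists_local_letter_QadjKinvSub_sub_flat`** — `∃ α₁ j₁ K κ` BEFORE the union binder block of gen 101's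
`B9Eq3133H1kPiTwoBackgroundLetterTower.exists_letter_H1kPi_sub_flat` (+ `hQ1`), then the display above.
HONEST SCOPE.  Composition BY NAME on the cell's MODEL rows (O-NE9-1; #5 UNRULED); constants crude; first order at the flat point; `j₀` and `α` displayed separately; the windows,
`c₀ = η^d`, unitarity, the tower data, the positivity and onto witnesses at `U` and at `1` stay HYPOTHESES; nothing of [B9] (3.126), (3.132)–(3.133) ∕ Thm 3.4 or [B11] (88) asserted
as printed; «NE9 ⇐ the named binders»; NE9 NOT PRINTED ∕ NOT PROVED; spine PROVED 0∕9; rung (B)+1 finite T⁴ — NOT infinite volume, NOT mass gap, NOT BetaPertH, NOT Clay.  HONEST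
DEPENDENCY: continuum YM on T⁴ ⇐ BetaPertH ∧ nine spine estimates (0/9 proved); BetaPertH ⇐ (D1) ∧ (D4) ∧ CAP+tail; G-an2-4 gates asym, D1 and NE2/3/4.  NEW file; nothing
modified.  Net new unproved facts: 0.
-/

noncomputable section

open scoped InnerProductSpace ComplexConjugate BigOperators

namespace Literature.MathematicalPhysics.QuantumFieldTheory.Balaban1983to89.B11Eq88LaplaceH1CurrentTwoBackgroundLetter

open B4Sect5Torus (TSite tdist tdist_nonneg tdist_symm tdist_self tdist_triangle torusSum_le)
open B4Sect5Proof (latticeConst latticeConst_nonneg)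
open B9SectCLatticeCarrier (Bond bpos shift unshift shift_unshift)
open B9Eq311L2Pairing (WL2)
open B9Eq319QprimeTorus (blockCoord)
open B7Prop1Explicit (U1 Wcx boxVec)
open B11Eq103H1Complex (SiteL2K BondL2K KinvLatticeK H1LatticeK)
open B9Eq310DeltaPrime (plaqHolU)
open B9Eq310HessianOperator (adTransportW hessOp)
open B9Eq315QTorus (perCfg cornerSite)
open B9Eq315QTower (towerP UlevOf)
open B9Eq315QTowerFlat (perCfg_UlevOf_one_mem_U1 norm_Wcx_UlevOf_one_sub_one_le)
open B9Eq316TowerFlatIsOneStep (towerP_eq_fineP_pow siteCast)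
open B9Eq326OperatorTower (QkW laplaceAk G1k H1k RofUk)
open B9Eq324DeltaPrimeATower (laplacePrimeAk)
open B9Eq3119DeltaPiTower (laplaceAkPi)
open B9Eq326G1SupRowOfLetters (letter_comp letter_mono)
open B9Eq349BlockDistanceWeight (tdist_shift_le_one)
open B9Eq315QkSingleBondLetter (norm_adjoint_QkW_apply_le_local_sharp)
open B9Eq315QkSingleBondTwoBackgroundLetter (norm_adjoint_QkW_sub_flat_apply_le_local_diagonal)
open B9Eq3132QGtildeQInvLetterClosed (exists_local_letter_KinvLatticeKPi)
open B9Eq3132KinvPiSubKinvLetterTower (exists_letter_KinvPi_sub_Kinv)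
open B9Eq3126KinvTwoBackgroundLetterTower (exists_letter_Kinv_sub_flat)
open B11Eq115Space

variable {d : ℕ} (hd : 1 ≤ d) (L : ℕ) [NeZero L] (hL : 1 ≤ L) (hL3 : 3 ≤ L)
  {𝔸 : Type*} [NormedRing 𝔸] [NormedAlgebra ℂ 𝔸] [CompleteSpace 𝔸] [NormOneClass 𝔸] [StarRing 𝔸] [NormedStarGroup 𝔸] [StarModule ℂ 𝔸] [FiniteDimensional ℂ 𝔸]
  {W : Type*} [NormedAddCommGroup W] [InnerProductSpace ℂ W] [FiniteDimensional ℂ W] (φ : W ≃ₗ[ℂ] 𝔸)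
  {Mφ Mφ' : ℝ} (hMφ : 0 ≤ Mφ) (hMφ' : 0 ≤ Mφ') (hφ : ∀ w, ‖φ w‖ ≤ Mφ * ‖w‖) (hφ' : ∀ X, ‖φ.symm X‖ ≤ Mφ' * ‖X‖) (hstar : ∀ X : 𝔸, ‖star X‖ ≤ ‖X‖)
  {a : ℝ} (ha : 0 < a) {a' : ℝ} (ha' : 0 < a') {ϱ : ℝ} (hϱ0 : 0 ≤ ϱ) (hϱ1 : ϱ < 1)
  (τ : 𝔸 →ₗ[ℂ] ℂ) {Cτ : ℝ} (hτ : ∀ X, ‖τ X‖ ≤ Cτ * ‖X‖) (hCτ : 0 ≤ Cτ) {Mτ : ℝ} (hτm : ∀ X Y : 𝔸, ‖τ (X * Y)‖ ≤ Mτ * ‖X‖ * ‖Y‖) (hMτ : 0 ≤ Mτ)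
  {ρw : ℝ} (hρw : 0 ≤ ρw)
  (hτ₁ : ∀ X : 𝔸, τ (star X) = conj (τ X)) (hτ₂ : ∀ X Y : 𝔸, τ (X * Y) = τ (Y * X)) (hφτ : ∀ X Y : 𝔸, ⟪φ.symm X, φ.symm Y⟫_ℂ = τ (star X * Y))
  (AQ : ℝ)
  {ι : Type} [Fintype ι] [DecidableEq ι] (b : Module.Basis ι ℝ 𝔸) {M₂ : ℝ} (hM₂ : 0 ≤ M₂) (hrepr : ∀ (v : 𝔸) (i : ι), |b.repr v i| ≤ M₂ * ‖v‖)


/-! ## The Hilbert-level composite letter between two backgrounds -/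

omit [NeZero L] in
/-- `e^{−r t} ≤ e^{−κ t}` for `κ ≤ r`, `0 ≤ t`. [folklore] -/
private theorem exp_weaken' {r κ t : ℝ} (hκ : κ ≤ r) (ht : 0 ≤ t) : Real.exp (-(r * t)) ≤ Real.exp (-(κ * t)) :=
  Real.exp_le_exp.2 (by nlinarith)

include hd hL hL3 hMφ hMφ' hφ hφ' hstar ha ha' hϱ0 hϱ1 hτ hCτ hτm hMτ hρw hτ₁ hτ₂ hφτ hM₂ hrepr in
set_option maxHeartbeats 3200000 in
set_option maxRecDepth 8192 in
/-- **THE HILBERT-LEVEL LETTER OF `Q_k†(K̃⁻¹ − a)` BETWEEN TWO BACKGROUNDS AT THE FLAT BASE** — see the module docstring: four letters composed (`letter_comp`, one rate loss),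
the `Q_k†` stations of range `1`, every constant chosen before `n, η, m, U`. [folklore]
[cite: Balaban1985BackgroundPropagators, (3.126) p.420, (3.132)–(3.133) p.422, Thm 3.4 p.400, (3.84)–(3.86) p.407; Balaban1985Variational, (88) p.291, (129) p.297, (117) p.295] -/
theorem exists_local_letter_QadjKinvSub_sub_flat :
    ∃ α₁ j₁ K κ : ℝ, 0 < α₁ ∧ 0 < j₁ ∧ 0 ≤ K ∧ 0 < κ ∧
      ∀ (n : ℕ) (η : ℝ) (_hηL : η * (L : ℝ) ^ (n + 1) = 1) (c₀ c₁ : ℝ) [Fact (0 < c₀)] [Fact (0 < c₁)]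
        (_hw : c₀ * ((L : ℝ) ^ (n + 1)) ^ d = c₁) (_hρ : |η| ^ d / c₀ ≤ ρw) (m : Fin d → ℕ) [∀ i, NeZero (m i)] (_hm : ∀ i, 1 ≤ m i)
        (U : Bond d (towerP L m (n + 1)) → 𝔸ˣ) (αU : ℕ → ℝ) (_hα0 : ∀ j, 0 ≤ αU j) (hα1 : ∀ j, αU j ≤ 1 / 64)
        (hαL : ∀ j, 50 * (d + 1) * αU j * (L : ℝ) ^ d ≤ 1 / 2)
        (hU1 : ∀ (j : ℕ) (x : B7Prop1Explicit.Site d) (k : Fin d), perCfg (towerP L m (j + 1)) (UlevOf L m (n + 1) U j) x k ∈ U1 𝔸)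
        (hreg : ∀ (j : ℕ) (y : TSite d (towerP L m j)) (k : Fin d) (ρ' : Fin d → Fin L),
          ‖((Wcx L (perCfg (towerP L m (j + 1)) (UlevOf L m (n + 1) U j)) (cornerSite L y) k (boxVec L ρ') : 𝔸ˣ) : 𝔸) - 1‖ ≤ αU j)
        (εU : ℕ → ℝ) (_hεU : ∀ j, 0 ≤ εU j) (_hε1 : ∀ j, εU j ≤ 1) (_hUε : ∀ (j : ℕ) (b : Bond d (towerP L m (j + 1))), ‖(UlevOf L m (n + 1) U j b : 𝔸) - 1‖ ≤ εU j)
        (_hLb : ∀ (j : ℕ) (b : Bond d (towerP L m (j + 1))), UlevOf L m (n + 1) U j b ∈ U1 𝔸)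
        (α : ℝ) (_hα : 0 ≤ α) (_hαle : α ≤ α₁)
        (hUst : ∀ b, star (U b : 𝔸) = (((U b)⁻¹ : 𝔸ˣ) : 𝔸)) (_hUb : ∀ b, U b ∈ U1 𝔸) (_hUη : ∀ b, ‖(U b : 𝔸) - 1‖ ≤ α * η)
        (_hUw : ∀ (x : TSite d (towerP L m (n + 1))) (μ ν : Fin d), ‖(U (shift ν x, μ) : 𝔸) - (U (x, μ) : 𝔸)‖ ≤ α * η ^ 2)
        (_hpl : ∀ p : B9SectCLatticeCarrier.Plaq d (towerP L m (n + 1)), ‖(plaqHolU U p : 𝔸) - 1‖ ≤ α * η ^ 2)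
        (_hUgrad : ∀ (x : TSite d (towerP L m (n + 1))) (μ : Fin d), ‖(U (x, μ) : 𝔸) - U (unshift μ x, μ)‖ ≤ α * η ^ 2)
        (_hRlev : ∀ (j : ℕ) (b : Bond d (towerP L m (j + 1))) (w : W), ‖adTransportW φ (UlevOf L m (n + 1) U j) b w‖ ≤ ‖w‖)
        (_hεg : ∀ j < n + 1, εU j ≤ α * ϱ ^ j) (_hAQ : ∑ j ∈ Finset.range (n + 1), αU j ≤ AQ)
        (hpos' : ∀ x : SiteL2K ℂ d (towerP L m (n + 1)) c₀ W, x ≠ 0 → 0 < RCLike.re ⟪x, laplacePrimeAk L m n φ η U a' (c₁ := c₁) x⟫_ℂ)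
        (hpos : ∀ x : BondL2K ℂ d (towerP L m (n + 1)) c₀ W, x ≠ 0 →
          0 < RCLike.re ⟪x, laplaceAk L m n φ η U hL αU hα1 hU1 hreg τ (c₀ := c₀) (c₁ := c₁) a x⟫_ℂ)
        (_hc₀η : c₀ = η ^ d) (j₀ : ℝ) (_hJ : ∀ μ y, ‖B9Eq39Adjoint.J (fun μ => B9Eq33CovDerivVector.shiftEquiv μ) (fun μ y => U (y, μ)) η μ y‖ ≤ j₀) (_hj : j₀ ≤ j₁)
        (hposπ : ∀ x : BondL2K ℂ d (towerP L m (n + 1)) c₀ W, x ≠ 0 →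
          0 < RCLike.re ⟪x, laplaceAkPi L m n φ τ η U a' hpos' hL αU hα1 hU1 hreg (c₁ := c₁) a x⟫_ℂ)
        (hQ : Function.Surjective (QkW L m n φ U hL αU hα1 hU1 hreg (c₀ := c₀) (c₁ := c₁)))
        (hpos'₁ : ∀ x : SiteL2K ℂ d (towerP L m (n + 1)) c₀ W, x ≠ 0 →
          0 < RCLike.re ⟪x, laplacePrimeAk L m n φ η (fun _ : Bond d (towerP L m (n + 1)) => (1 : 𝔸ˣ)) a' (c₁ := c₁) x⟫_ℂ)
        (hpos₁ : ∀ x : BondL2K ℂ d (towerP L m (n + 1)) c₀ W, x ≠ 0 →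
          0 < RCLike.re ⟪x, laplaceAk L m n φ η (fun _ : Bond d (towerP L m (n + 1)) => (1 : 𝔸ˣ)) hL (fun _ => 0) (fun _ => by norm_num)
            (perCfg_UlevOf_one_mem_U1 L m (n + 1)) (norm_Wcx_UlevOf_one_sub_one_le L m (n + 1) (fun _ => 0) (fun _ => le_rfl)) τ
            (c₀ := c₀) (c₁ := c₁) a x⟫_ℂ)
        (hQ1 : Function.Surjective (QkW L m n φ (fun _ : Bond d (towerP L m (n + 1)) => (1 : 𝔸ˣ)) hL (fun _ => 0) (fun _ => by norm_num)
          (perCfg_UlevOf_one_mem_U1 L m (n + 1)) (norm_Wcx_UlevOf_one_sub_one_le L m (n + 1) (fun _ => 0) (fun _ => le_rfl)) (c₀ := c₀) (c₁ := c₁)))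
        (v : TSite d m) (z : BondL2K ℂ d m c₁ W) (F : ℝ)
        (_hzv : ∀ c', bpos c' ≠ v → WL2.equiv ℂ (fun _ : Bond d m => c₁) W z c' = 0)
        (_hzF : ∀ c', ‖WL2.equiv ℂ (fun _ : Bond d m => c₁) W z c'‖ ≤ F) (bd : Bond d (towerP L m (n + 1))),
        ‖WL2.equiv ℂ (fun _ : Bond d (towerP L m (n + 1)) => c₀) W
            ((LinearMap.adjoint (QkW L m n φ U hL αU hα1 hU1 hreg (c₀ := c₀) (c₁ := c₁)) (KinvLatticeK hposπ hQ z)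
              - (a : ℂ) • LinearMap.adjoint (QkW L m n φ U hL αU hα1 hU1 hreg (c₀ := c₀) (c₁ := c₁)) z) -
            (LinearMap.adjoint (QkW L m n φ (fun _ : Bond d (towerP L m (n + 1)) => (1 : 𝔸ˣ)) hL (fun _ => 0) (fun _ => by norm_num)
            (perCfg_UlevOf_one_mem_U1 L m (n + 1)) (norm_Wcx_UlevOf_one_sub_one_le L m (n + 1) (fun _ => 0) (fun _ => le_rfl)) (c₀ := c₀) (c₁ := c₁))
                (KinvLatticeK (c := ((η : ℂ))⁻¹) (R := adTransportW φ (fun _ : Bond d (towerP L m (n + 1)) => (1 : 𝔸ˣ)))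
                (S := adTransportW φ fun _ : Bond d (towerP L m (n + 1)) => (1 : 𝔸ˣ)⁻¹) (Δ₁ := hessOp φ η (fun _ : Bond d (towerP L m (n + 1)) => (1 : 𝔸ˣ)) τ)
                (Rr := RofUk L m n φ η (fun _ : Bond d (towerP L m (n + 1)) => (1 : 𝔸ˣ)))
                (Q := (QkW L m n φ (fun _ : Bond d (towerP L m (n + 1)) => (1 : 𝔸ˣ)) hL (fun _ => 0) (fun _ => by norm_num)
                  (perCfg_UlevOf_one_mem_U1 L m (n + 1)) (norm_Wcx_UlevOf_one_sub_one_le L m (n + 1) (fun _ => 0) (fun _ => le_rfl)) (c₀ := c₀) (c₁ := c₁))) (a := a)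
                hpos₁ hQ1 z)
              - (a : ℂ) • LinearMap.adjoint (QkW L m n φ (fun _ : Bond d (towerP L m (n + 1)) => (1 : 𝔸ˣ)) hL (fun _ => 0) (fun _ => by norm_num)
            (perCfg_UlevOf_one_mem_U1 L m (n + 1)) (norm_Wcx_UlevOf_one_sub_one_le L m (n + 1) (fun _ => 0) (fun _ => le_rfl)) (c₀ := c₀) (c₁ := c₁)) z)) bd‖ ≤
          (j₀ + α) * K * Real.exp (-(κ * tdist m (blockCoord (L ^ (n + 1)) m (siteCast (towerP_eq_fineP_pow L m (n + 1)) (bpos bd))) v)) * F := by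
  classical
  -- (0) the suppliers, `∃`-first
  obtain ⟨αK, jK, BK, δK, hαK, hjK, hBK, hδK, HKi⟩ :=
    exists_local_letter_KinvLatticeKPi hd L hL hL3 φ hMφ hMφ' hφ hφ' hstar ha ha' hϱ0 hϱ1 τ hτ hCτ hτm hMτ hρw hτ₁ hτ₂ hφτ AQ
  obtain ⟨αX, jX, KX, κX, hαX, hjX, hKX, hκX, HX⟩ :=
    exists_letter_KinvPi_sub_Kinv hd L hL hL3 φ hMφ hMφ' hφ hφ' hstar ha ha' hϱ0 hϱ1 τ hτ hCτ hτm hMτ hρw hτ₁ hτ₂ hφτ AQ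
  obtain ⟨αV, KV, κV, hαV, hKV, hκV, HV⟩ :=
    exists_letter_Kinv_sub_flat hd L hL hL3 φ hMφ hMφ' hφ hφ' hstar ha ha' hϱ0 hϱ1 τ hτ hCτ hτm hMτ hρw hτ₁ hτ₂ hφτ b hM₂ hrepr AQ
  set κ₀ : ℝ := min δK (min κX κV) with hκ₀
  have hκ₀0 : 0 < κ₀ := lt_min hδK (lt_min hκX hκV)
  have hκ₀K : κ₀ ≤ δK := min_le_left _ _
  have hκ₀X : κ₀ ≤ κX := (min_le_right _ _).trans (min_le_left _ _)
  have hκ₀V : κ₀ ≤ κV := (min_le_right _ _).trans (min_le_right _ _)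
  set S : ℝ := latticeConst d (κ₀ / 2) with hS
  have hS0 : 0 ≤ S := latticeConst_nonneg d (half_pos hκ₀0).le
  have h1r : 0 < 1 - ϱ := by linarith
  set EA : ℝ := Real.exp (100 * d * (d + 1) * (L : ℝ) ^ d * AQ) with hEA
  set KSU : ℝ := Mφ' * Mφ * EA * ((2 * d : ℕ) : ℝ) * Real.exp κ₀ with hKSU
  set KSd : ℝ := Mφ' * Mφ * ((L : ℝ) ^ d * (2 * d * (102 * ((d : ℝ) + 1) ^ 2 * L)) * (1 / (1 - ϱ)) * EA) * ((2 * d : ℕ) : ℝ) * Real.exp κ₀ with hKSd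
  have hKSU0 : 0 ≤ KSU := by positivity
  have hKSd0 : 0 ≤ KSd := by positivity
  set K : ℝ := BK * KSd * S + KX * KSU * S + KV * KSU * S + a * KSd with hK
  have hK0 : 0 ≤ K := by have := ha.le; positivity
  refine ⟨min αK (min αX αV), min jK jX, K, κ₀ / 2, lt_min hαK (lt_min hαX hαV), lt_min hjK hjX, hK0, half_pos hκ₀0, ?_⟩
  intro n η hηL c₀ c₁ _ _ hw hρ m _ hm U αU hα0 hα1 hαL hU1 hreg εU hεU hε1 hUε hLb α hα hαle hUst hUb hUη hUw hpl hUgrad hRlev hεg hAQ hpos' hpos hc₀η j₀ hJ hj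
    hposπ hQ hpos'₁ hpos₁ hQ1 v z F hzv hzF bd
  have hαK' : α ≤ αK := hαle.trans (min_le_left _ _)
  have hαX' : α ≤ αX := hαle.trans ((min_le_right _ _).trans (min_le_left _ _))
  have hαV' : α ≤ αV := hαle.trans ((min_le_right _ _).trans (min_le_right _ _))
  have hjK' : j₀ ≤ jK := hj.trans (min_le_left _ _)
  have hjX' : j₀ ≤ jX := hj.trans (min_le_right _ _)
  haveI : Nonempty (Bond d m) := ⟨(v, ⟨0, hd⟩)⟩
  haveI : Nonempty (Bond d (towerP L m (n + 1))) := ⟨bd⟩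
  have hF : 0 ≤ F := (norm_nonneg _).trans (hzF (v, ⟨0, hd⟩))
  have hj₀ : 0 ≤ j₀ := (norm_nonneg _).trans (hJ ⟨0, hd⟩ fun _ => 0)
  have hc₀ : (0 : ℝ) < c₀ := Fact.out
  have hLd : (0 : ℝ) < ((L : ℝ) ^ (n + 1)) ^ d := pow_pos (pow_pos (Nat.cast_pos.2 hL) _) _
  have hAQ0 : (0 : ℝ) ≤ AQ := (Finset.sum_nonneg fun j _ => hα0 j).trans hAQ
  have hAQ1 : ∑ j ∈ Finset.range (n + 1), (fun _ : ℕ => (0 : ℝ)) j ≤ AQ := by simpa using hAQ0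
  -- names
  set piS : TSite d (towerP L m (n + 1)) → TSite d m := fun x => blockCoord (L ^ (n + 1)) m (siteCast (towerP_eq_fineP_pow L m (n + 1)) x) with hpiS
  set piB : Bond d (towerP L m (n + 1)) → TSite d m := fun b' => piS (bpos b') with hpiB
  set piC : Bond d m → TSite d m := fun c => bpos c with hpiC
  -- the CLMs
  obtain ⟨Kp, hKp⟩ : ∃ T : BondL2K ℂ d m c₁ W →L[ℂ] BondL2K ℂ d m c₁ W, T = LinearMap.toContinuousLinearMap (KinvLatticeK hposπ hQ) := ⟨_, rfl⟩
  obtain ⟨Kx, hKx⟩ : ∃ T : BondL2K ℂ d m c₁ W →L[ℂ] BondL2K ℂ d m c₁ W, T = LinearMap.toContinuousLinearMap (KinvLatticeK hposπ hQ - KinvLatticeK hpos hQ) := ⟨_, rfl⟩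
  obtain ⟨Kv, hKv⟩ : ∃ T : BondL2K ℂ d m c₁ W →L[ℂ] BondL2K ℂ d m c₁ W, T = LinearMap.toContinuousLinearMap (KinvLatticeK hpos hQ -
      KinvLatticeK (c := ((η : ℂ))⁻¹) (R := adTransportW φ (fun _ : Bond d (towerP L m (n + 1)) => (1 : 𝔸ˣ)))
        (S := adTransportW φ fun _ : Bond d (towerP L m (n + 1)) => (1 : 𝔸ˣ)⁻¹) (Δ₁ := hessOp φ η (fun _ : Bond d (towerP L m (n + 1)) => (1 : 𝔸ˣ)) τ)
        (Rr := RofUk L m n φ η (fun _ : Bond d (towerP L m (n + 1)) => (1 : 𝔸ˣ)))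
        (Q := (QkW L m n φ (fun _ : Bond d (towerP L m (n + 1)) => (1 : 𝔸ˣ)) hL (fun _ => 0) (fun _ => by norm_num)
          (perCfg_UlevOf_one_mem_U1 L m (n + 1)) (norm_Wcx_UlevOf_one_sub_one_le L m (n + 1) (fun _ => 0) (fun _ => le_rfl)) (c₀ := c₀) (c₁ := c₁))) (a := a)
        hpos₁ hQ1) := ⟨_, rfl⟩
  obtain ⟨SU1, hSU1⟩ : ∃ T : BondL2K ℂ d m c₁ W →L[ℂ] BondL2K ℂ d (towerP L m (n + 1)) c₀ W, T = LinearMap.toContinuousLinearMap (LinearMap.adjoint (QkW L m n φ (fun _ : Bond d (towerP L m (n + 1)) => (1 : 𝔸ˣ)) hL (fun _ => 0) (fun _ => by norm_num)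
            (perCfg_UlevOf_one_mem_U1 L m (n + 1)) (norm_Wcx_UlevOf_one_sub_one_le L m (n + 1) (fun _ => 0) (fun _ => le_rfl)) (c₀ := c₀) (c₁ := c₁))) := ⟨_, rfl⟩
  obtain ⟨Sd, hSd⟩ : ∃ T : BondL2K ℂ d m c₁ W →L[ℂ] BondL2K ℂ d (towerP L m (n + 1)) c₀ W,
      T = LinearMap.toContinuousLinearMap (LinearMap.adjoint (QkW L m n φ U hL αU hα1 hU1 hreg (c₀ := c₀) (c₁ := c₁)) -
        LinearMap.adjoint (QkW L m n φ (fun _ : Bond d (towerP L m (n + 1)) => (1 : 𝔸ˣ)) hL (fun _ => 0) (fun _ => by norm_num)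
            (perCfg_UlevOf_one_mem_U1 L m (n + 1)) (norm_Wcx_UlevOf_one_sub_one_le L m (n + 1) (fun _ => 0) (fun _ => le_rfl)) (c₀ := c₀) (c₁ := c₁))) := ⟨_, rfl⟩
  -- (1) the three `K⁻¹`-letters at the common rate `κ₀`
  have hLKp : ∀ (w : TSite d m) (h : BondL2K ℂ d m c₁ W) (H : ℝ), (∀ c, piC c ≠ w → WL2.equiv ℂ (fun _ : Bond d m => c₁) W h c = 0) →
      (∀ c, ‖WL2.equiv ℂ (fun _ : Bond d m => c₁) W h c‖ ≤ H) →
      ∀ c, ‖WL2.equiv ℂ (fun _ : Bond d m => c₁) W (Kp h) c‖ ≤ BK * Real.exp (-(κ₀ * tdist m (piC c) w)) * H := by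
    intro w h H hhv hhF c
    have hH : 0 ≤ H := (norm_nonneg _).trans (hhF c)
    rw [hKp, LinearMap.coe_toContinuousLinearMap']
    exact (HKi n η hηL c₀ c₁ hw hρ m hm U αU hα0 hα1 hαL hU1 hreg εU hεU hUε hLb α hα hαK' hUst hUb hUη hpl hUgrad hRlev hεg hAQ hpos' hpos hc₀η j₀ hJ hjK'
      hposπ hQ w h H hhv hhF c).trans (mul_le_mul_of_nonneg_right (mul_le_mul_of_nonneg_left (exp_weaken' hκ₀K (tdist_nonneg m _ _)) hBK) hH)
  have hLKx : ∀ (w : TSite d m) (h : BondL2K ℂ d m c₁ W) (H : ℝ), (∀ c, piC c ≠ w → WL2.equiv ℂ (fun _ : Bond d m => c₁) W h c = 0) →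
      (∀ c, ‖WL2.equiv ℂ (fun _ : Bond d m => c₁) W h c‖ ≤ H) →
      ∀ c, ‖WL2.equiv ℂ (fun _ : Bond d m => c₁) W (Kx h) c‖ ≤ (j₀ * KX) * Real.exp (-(κ₀ * tdist m (piC c) w)) * H := by
    intro w h H hhv hhF c
    have hH : 0 ≤ H := (norm_nonneg _).trans (hhF c)
    rw [hKx, LinearMap.coe_toContinuousLinearMap']
    exact (HX n η hηL c₀ c₁ hw hρ m hm U αU hα0 hα1 hαL hU1 hreg εU hεU hUε hLb α hα hαX' hUst hUb hUη hpl hUgrad hRlev hεg hAQ hpos' hpos hc₀η j₀ hJ hjX'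
      hposπ hQ w h H hhv hhF c).trans (mul_le_mul_of_nonneg_right (mul_le_mul_of_nonneg_left (exp_weaken' hκ₀X (tdist_nonneg m _ _)) (mul_nonneg hj₀ hKX)) hH)
  have hLKv : ∀ (w : TSite d m) (h : BondL2K ℂ d m c₁ W) (H : ℝ), (∀ c, piC c ≠ w → WL2.equiv ℂ (fun _ : Bond d m => c₁) W h c = 0) →
      (∀ c, ‖WL2.equiv ℂ (fun _ : Bond d m => c₁) W h c‖ ≤ H) →
      ∀ c, ‖WL2.equiv ℂ (fun _ : Bond d m => c₁) W (Kv h) c‖ ≤ (KV * α) * Real.exp (-(κ₀ * tdist m (piC c) w)) * H := by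
    intro w h H hhv hhF c
    have hH : 0 ≤ H := (norm_nonneg _).trans (hhF c)
    rw [hKv, LinearMap.coe_toContinuousLinearMap']
    exact (HV n η hηL c₀ c₁ hw hρ m hm U α hα hαV' hUb hUη hUw hpl hUst αU hα0 hα1 hαL hAQ hU1 hreg εU hεU hε1 hεg hUε hLb hRlev hpos' hpos hpos'₁ hpos₁ hQ hQ1
      w h H hhv hhF c).trans (mul_le_mul_of_nonneg_right (mul_le_mul_of_nonneg_left (exp_weaken' hκ₀V (tdist_nonneg m _ _)) (mul_nonneg hKV hα)) hH)
  -- (2) the two `Q_k†` stations: sources on the coarse bonds at `w`, outputs within one block (`e^{κ₀}`)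
  have hcomp : ∀ {D : ℝ}, D ≤ 1 → (1 : ℝ) ≤ Real.exp κ₀ * Real.exp (-(κ₀ * D)) := fun {D} hD => by
    rw [← Real.exp_add]; exact Real.one_le_exp (by nlinarith [mul_le_mul_of_nonneg_left hD hκ₀0.le])
  have hzone : ∀ (w : TSite d m) (h : BondL2K ℂ d m c₁ W) (H : ℝ), (∀ c, piC c ≠ w → WL2.equiv ℂ (fun _ : Bond d m => c₁) W h c = 0) →
      (∀ c, ‖WL2.equiv ℂ (fun _ : Bond d m => c₁) W h c‖ ≤ H) → ∀ (b' : Bond d (towerP L m (n + 1))) (c : Bond d m),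
      (blockCoord (L ^ (n + 1)) m (siteCast (towerP_eq_fineP_pow L m (n + 1)) b'.1) = c.1 ∨
        blockCoord (L ^ (n + 1)) m (siteCast (towerP_eq_fineP_pow L m (n + 1)) b'.1) = shift c.2 c.1) →
      ‖WL2.equiv ℂ (fun _ : Bond d m => c₁) W h c‖ ≤ Real.exp κ₀ * Real.exp (-(κ₀ * tdist m (piB b') w)) * H := by
    intro w h H hhv hhF b' c hc
    have hH : 0 ≤ H := (norm_nonneg _).trans (hhF c)
    by_cases hcw : c.1 = w
    · have hD : tdist m (piB b') w ≤ 1 := by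
        show tdist m (blockCoord (L ^ (n + 1)) m (siteCast (towerP_eq_fineP_pow L m (n + 1)) b'.1)) w ≤ 1
        rcases hc with hc | hc
        · rw [hc, hcw, tdist_self]; exact zero_le_one
        · rw [hc, ← hcw, tdist_symm hm]; exact tdist_shift_le_one hm c.1 c.2
      calc ‖WL2.equiv ℂ (fun _ : Bond d m => c₁) W h c‖ ≤ 1 * H := by rw [one_mul]; exact hhF c
        _ ≤ (Real.exp κ₀ * Real.exp (-(κ₀ * tdist m (piB b') w))) * H := mul_le_mul_of_nonneg_right (hcomp hD) hH
        _ = _ := by ring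
    · rw [hhv c hcw, norm_zero]; positivity
  have hLSU1 : ∀ (w : TSite d m) (h : BondL2K ℂ d m c₁ W) (H : ℝ), (∀ c, piC c ≠ w → WL2.equiv ℂ (fun _ : Bond d m => c₁) W h c = 0) →
      (∀ c, ‖WL2.equiv ℂ (fun _ : Bond d m => c₁) W h c‖ ≤ H) →
      ∀ b', ‖WL2.equiv ℂ (fun _ : Bond d (towerP L m (n + 1)) => c₀) W (SU1 h) b'‖ ≤ KSU * Real.exp (-(κ₀ * tdist m (piB b') w)) * H := by
    intro w h H hhv hhF b'
    have hH : 0 ≤ H := (norm_nonneg _).trans (hhF (w, bd.2))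
    rw [hSU1, LinearMap.coe_toContinuousLinearMap']
    have hM : 0 ≤ Real.exp κ₀ * Real.exp (-(κ₀ * tdist m (piB b') w)) * H := by positivity
    have h1 := norm_adjoint_QkW_apply_le_local_sharp (c₀ := c₀) (c₁ := c₁) L m n φ (fun _ : Bond d (towerP L m (n + 1)) => (1 : 𝔸ˣ)) hL (fun _ => 0)
      (fun _ => le_rfl) (fun _ => by norm_num) (perCfg_UlevOf_one_mem_U1 L m (n + 1)) (norm_Wcx_UlevOf_one_sub_one_le L m (n + 1) (fun _ => 0) (fun _ => le_rfl))
      hMφ hφ hMφ' hφ' hAQ1 h b' hM (hzone w h H hhv hhF b')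
    have he : c₁ / c₀ * (Mφ' * ((((L : ℝ) ^ (n + 1)) ^ d)⁻¹ * Real.exp (100 * d * (d + 1) * (L : ℝ) ^ d * AQ)) * Mφ) = Mφ' * Mφ * EA := by
      rw [hEA, ← hw]; field_simp
    rw [he] at h1
    exact h1.trans (le_of_eq (by rw [hKSU]; ring))
  have hLSd : ∀ (w : TSite d m) (h : BondL2K ℂ d m c₁ W) (H : ℝ), (∀ c, piC c ≠ w → WL2.equiv ℂ (fun _ : Bond d m => c₁) W h c = 0) →
      (∀ c, ‖WL2.equiv ℂ (fun _ : Bond d m => c₁) W h c‖ ≤ H) →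
      ∀ b', ‖WL2.equiv ℂ (fun _ : Bond d (towerP L m (n + 1)) => c₀) W (Sd h) b'‖ ≤ (KSd * α) * Real.exp (-(κ₀ * tdist m (piB b') w)) * H := by
    intro w h H hhv hhF b'
    have hH : 0 ≤ H := (norm_nonneg _).trans (hhF (w, bd.2))
    rw [hSd, LinearMap.coe_toContinuousLinearMap', LinearMap.sub_apply, WL2.equiv_sub, Pi.sub_apply]
    have hM : 0 ≤ Real.exp κ₀ * Real.exp (-(κ₀ * tdist m (piB b') w)) * H := by positivity
    have h1 := norm_adjoint_QkW_sub_flat_apply_le_local_diagonal L m n φ U hL αU hα0 hα1 hU1 hreg εU hεU hUε hϱ0 hϱ1 hα hεg hMφ hφ hMφ' hφ' hAQ hw h b' hM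
      (hzone w h H hhv hhF b')
    exact h1.trans (le_of_eq (by rw [hKSd, hEA]; ring))
  -- (3) the three compositions (row sum `S = K_d(κ₀/2)`) and the direct `Q†`-term
  have hrow : ∀ w : TSite d m, ∑ u, Real.exp (-((κ₀ - κ₀ / 2) * tdist m w u)) ≤ S := fun w => by
    rw [show κ₀ - κ₀ / 2 = κ₀ / 2 by ring]; exact torusSum_le d hm (half_pos hκ₀0) w
  have hδ0 : ∀ u v : TSite d m, 0 ≤ tdist m u v := fun u v => tdist_nonneg _ _ _
  have hδt : ∀ u y v : TSite d m, tdist m u v ≤ tdist m u y + tdist m y v := fun u y v => tdist_triangle hm u y v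
  have hκ'0 : (0 : ℝ) ≤ κ₀ / 2 := by positivity
  have hκ'1 : κ₀ / 2 ≤ κ₀ := by linarith
  have hT1 := letter_comp (𝕜 := ℂ) (tdist m) piC piC piB Kp Sd hδ0 hδt hBK (mul_nonneg hKSd0 hα) hκ'0 hκ'1 hLKp hLSd hrow v z F hzv hzF bd
  have hT2 := letter_comp (𝕜 := ℂ) (tdist m) piC piC piB Kx SU1 hδ0 hδt (mul_nonneg hj₀ hKX) hKSU0 hκ'0 hκ'1 hLKx hLSU1 hrow v z F hzv hzF bd
  have hT3 := letter_comp (𝕜 := ℂ) (tdist m) piC piC piB Kv SU1 hδ0 hδt (mul_nonneg hKV hα) hKSU0 hκ'0 hκ'1 hLKv hLSU1 hrow v z F hzv hzF bd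
  have hT4 : ‖WL2.equiv ℂ (fun _ : Bond d (towerP L m (n + 1)) => c₀) W (Sd z) bd‖ ≤ (KSd * α) * Real.exp (-(κ₀ / 2 * tdist m (piB bd) v)) * F :=
    (hLSd v z F hzv hzF bd).trans (mul_le_mul_of_nonneg_right (mul_le_mul_of_nonneg_left (exp_weaken' hκ'1 (hδ0 _ _)) (mul_nonneg hKSd0 hα)) hF)
  -- (4) the algebraic split
  have hsplit : (LinearMap.adjoint (QkW L m n φ U hL αU hα1 hU1 hreg (c₀ := c₀) (c₁ := c₁)) (KinvLatticeK hposπ hQ z) - (a : ℂ) • LinearMap.adjoint (QkW L m n φ U hL αU hα1 hU1 hreg (c₀ := c₀) (c₁ := c₁)) z) -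
      (LinearMap.adjoint (QkW L m n φ (fun _ : Bond d (towerP L m (n + 1)) => (1 : 𝔸ˣ)) hL (fun _ => 0) (fun _ => by norm_num)
            (perCfg_UlevOf_one_mem_U1 L m (n + 1)) (norm_Wcx_UlevOf_one_sub_one_le L m (n + 1) (fun _ => 0) (fun _ => le_rfl)) (c₀ := c₀) (c₁ := c₁)) ((KinvLatticeK (c := ((η : ℂ))⁻¹) (R := adTransportW φ (fun _ : Bond d (towerP L m (n + 1)) => (1 : 𝔸ˣ)))
                (S := adTransportW φ fun _ : Bond d (towerP L m (n + 1)) => (1 : 𝔸ˣ)⁻¹) (Δ₁ := hessOp φ η (fun _ : Bond d (towerP L m (n + 1)) => (1 : 𝔸ˣ)) τ)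
                (Rr := RofUk L m n φ η (fun _ : Bond d (towerP L m (n + 1)) => (1 : 𝔸ˣ)))
                (Q := (QkW L m n φ (fun _ : Bond d (towerP L m (n + 1)) => (1 : 𝔸ˣ)) hL (fun _ => 0) (fun _ => by norm_num)
                  (perCfg_UlevOf_one_mem_U1 L m (n + 1)) (norm_Wcx_UlevOf_one_sub_one_le L m (n + 1) (fun _ => 0) (fun _ => le_rfl)) (c₀ := c₀) (c₁ := c₁))) (a := a)
                hpos₁ hQ1 z)) - (a : ℂ) • LinearMap.adjoint (QkW L m n φ (fun _ : Bond d (towerP L m (n + 1)) => (1 : 𝔸ˣ)) hL (fun _ => 0) (fun _ => by norm_num)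
            (perCfg_UlevOf_one_mem_U1 L m (n + 1)) (norm_Wcx_UlevOf_one_sub_one_le L m (n + 1) (fun _ => 0) (fun _ => le_rfl)) (c₀ := c₀) (c₁ := c₁)) z) =
      (Sd ∘L Kp) z + (SU1 ∘L Kx) z + (SU1 ∘L Kv) z - (a : ℂ) • Sd z := by
    simp only [ContinuousLinearMap.coe_comp, Function.comp_apply]
    rw [hKp, hKx, hKv, hSU1, hSd]
    simp only [LinearMap.coe_toContinuousLinearMap']
    simp only [LinearMap.sub_apply, map_sub, smul_sub]
    abel
  rw [hsplit, WL2.equiv_sub, WL2.equiv_add, WL2.equiv_add, WL2.equiv_smul, Pi.sub_apply, Pi.add_apply, Pi.add_apply, Pi.smul_apply]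
  set E : ℝ := Real.exp (-(κ₀ / 2 * tdist m (piB bd) v)) with hE
  have hE0 : 0 ≤ E := Real.exp_nonneg _
  have ha4 : ‖(a : ℂ) • WL2.equiv ℂ (fun _ : Bond d (towerP L m (n + 1)) => c₀) W (Sd z) bd‖ ≤ a * ((KSd * α) * E * F) := by
    rw [norm_smul, Complex.norm_real, Real.norm_of_nonneg ha.le]; exact mul_le_mul_of_nonneg_left hT4 ha.le
  calc _ ≤ ‖WL2.equiv ℂ (fun _ : Bond d (towerP L m (n + 1)) => c₀) W ((Sd ∘L Kp) z) bd‖ + ‖WL2.equiv ℂ (fun _ : Bond d (towerP L m (n + 1)) => c₀) W ((SU1 ∘L Kx) z) bd‖ +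
        ‖WL2.equiv ℂ (fun _ : Bond d (towerP L m (n + 1)) => c₀) W ((SU1 ∘L Kv) z) bd‖ + ‖(a : ℂ) • WL2.equiv ℂ (fun _ : Bond d (towerP L m (n + 1)) => c₀) W (Sd z) bd‖ :=
        (norm_sub_le _ _).trans (add_le_add ((norm_add_le _ _).trans (add_le_add (norm_add_le _ _) le_rfl)) le_rfl)
    _ ≤ BK * (KSd * α) * S * E * F + (j₀ * KX) * KSU * S * E * F + (KV * α) * KSU * S * E * F + a * ((KSd * α) * E * F) :=
        add_le_add (add_le_add (add_le_add hT1 hT2) hT3) ha4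
    _ ≤ (j₀ + α) * K * E * F := by
        have h1 : 0 ≤ α * (BK * KSd * S) * E * F := by positivity
        have h2 : 0 ≤ j₀ * (KX * KSU * S) * E * F := by positivity
        have h3 : 0 ≤ α * (KV * KSU * S) * E * F := by positivity
        have h4 : 0 ≤ j₀ * (KV * KSU * S + BK * KSd * S + a * KSd) * E * F := by have := ha.le; positivity
        have h5 : 0 ≤ α * (KX * KSU * S) * E * F := by positivity
        rw [hK]; nlinarith [h1, h2, h3, h4, h5]

end Literature.MathematicalPhysics.QuantumFieldTheory.Balaban1983to89.B11Eq88LaplaceH1CurrentTwoBackgroundLetter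

end
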